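import Mathlib
import HarnessLib
import Summits.NavierStokesRegularity.NavierStokesRegularity.Theses.RootDecompLeanestSingularity
import Summits.NavierStokesRegularity.NavierStokesRegularity.Theorems.RootDecompLeanestSingularityNoHollowSpike
import Summits.NavierStokesRegularity.NavierStokesRegularity.Theorems.RootDecompLeanestSingularityNoFrozenSpike

/-!
# RootDecompLeanestSingularity — both exits of N are closed: the Matano–Merle exit statement X is N in disguise

Route N14 `route-NavierStokesRegularity-RootDecompLeanestSingularity`, residual crux N `LeanEnvelopedIsTypeI`
(stmt-NavierStokesRegularity-32146, «an enveloped lean threshold is Type I in time»). The lens-4 g11 SPIKE ANATOMY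
recorded the one printed mechanism for a Type-II threshold, the Matano–Merle «exit» (MM 2004 / 2009: a threshold
Type-II blow-up converges, rescaled and along a sequence, to a STEADY state or empties out), as the statement
X `LeanTypeIIFrozenOrHollow`: every enveloped lean marginal Clay blow-up which is NOT Type I in time has a zoom limit
in the bounded Oseen ancient class, nontrivial, which is FROZEN (time independent) or has a HOLLOW slice (a slice in
`𝔹` with vanishing Navier–Stokes blow-down). X was deliberately NOT booked (lens `frozenOrHollow_iff_noEnveloped`:
«X ↔ N modulo the routine stub S2»).

With the two anatomy theorems now LANDED — K `NoHollowSpike.noHollowSpike_proof` (writer g12) and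
F `NoFrozenSpike.noFrozenSpike_proof` (writer g13, after S2 `FrozenZoomIsLerayProfile`) — this file lands the
kernel edge unconditionally and BY NAME on the born decl: `X ↔ Theses.RootDecompLeanestSingularity.LeanEnvelopedIsTypeI`
(X written out with the lens vocabulary `NearMinimal` / `IsEnveloped` / `IsZoomLimit` / `InOseenClass` /
`IsNontrivialFlow` / `IsFrozen` / `HasHollowSlice` unfolded exactly as in the born decls of N, F and K; no new
definitions). Reading: inside a weak-`L³` envelope a Navier–Stokes blow-up core can neither freeze (F) nor hollow
out (K), so the Matano–Merle exit statement can only hold vacuously, i.e. as N itself — the open content of N is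
EXACTLY «an enveloped Type-II lean threshold has SOME frozen-or-hollow zoom limit», and any proof of N through a
zoom limit must produce a limit that is live, non-steady and non-hollow at every slice. Navier–Stokes regularity is
NOT proved by anything here (rung 0); N and E `LeanTypeIIEnveloped` (32147) stay open.

Sources: MatanoMerle2004 (CPAM 57) / MatanoMerle2009 (the threshold exit mechanism, NLH); arXiv:1811.00502
(Albritton–Barker 2019, weak-`L³` envelope (b) vs rate (c_∞), Thm 4.1); Tsai2021 Thm 1.1(a) and
KochNadirashviliSereginSverak2009 §4 (the inputs of F and K). decomp-ns writer g13.
-/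

set_option linter.dupNamespace false

open MeasureTheory Set Filter Function Topology

namespace Summit.NavierStokesRegularity.NavierStokesRegularity.Theorems.SpikeExits

open Literature.Analysis.FluidPDE Literature.Analysis.UnboundedOperators Literature.Analysis.FunctionSpaces

/-- **X ⟹ N given the anatomy (both exits landed).** If every enveloped lean marginal Clay blow-up that is not
Type I in time had a nontrivial zoom limit in the bounded Oseen ancient class which is frozen or has a hollow
slice, then — since F `NoFrozenSpike` forbids the frozen exit and K `NoHollowSpike` the hollow one — no enveloped
lean marginal blow-up is Type II in time, i.e. N `LeanEnvelopedIsTypeI` holds. [lens-4 g11 SPIKE ANATOMY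
`leanEnvelopedIsTypeI_of_frozenOrHollow`, now unconditional] -/
theorem leanEnvelopedIsTypeI_of_frozenOrHollow
    (hX : ∃ ε : ℝ, 0 < ε ∧ ∀ (ν T : ℝ), 0 < ν → 0 < T →
      ∀ (u : ℝ → EuclideanSpace ℝ (Fin 3) → EuclideanSpace ℝ (Fin 3)) (p : ℝ → EuclideanSpace ℝ (Fin 3) → ℝ),
      IsMaximalSmoothSolution ν 0 u p T → IsLerayHopfOn T ν 0 (u 0) u → HasRapidSpatialDecay (u 0) →
      (∀ ν' : ℝ, ν < ν' → HasGlobalKatoSolution ν' (u 0)) →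
      (∀ v : EuclideanSpace ℝ (Fin 3) → EuclideanSpace ℝ (Fin 3),
        (ContDiff ℝ (⊤ : ℕ∞) v ∧ NSWave0.IsDivFree v ∧ HasRapidSpatialDecay v) →
        ¬ HasGlobalKatoSolution ν v → eLpNorm (u 0) 3 volume ≤ ENNReal.ofReal (1 + ε) * eLpNorm v 3 volume) →
      ¬ IsTypeIBlowup u T →
      (∃ M : ENNReal, M < ⊤ ∧ ∀ t : ℝ, 0 ≤ t → t < T → ∀ σ : ℝ, 0 < σ →
        ENNReal.ofReal σ ^ 3 * volume {x : EuclideanSpace ℝ (Fin 3) | σ < ‖u t x‖} ≤ M) →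
      ∃ U : ℝ → EuclideanSpace ℝ (Fin 3) → EuclideanSpace ℝ (Fin 3),
        (∃ (tc : ℕ → ℝ) (xc : ℕ → EuclideanSpace ℝ (Fin 3)) (lam : ℕ → ℝ), (∀ k, 0 < lam k) ∧
          (∀ k, tc k < T) ∧ (∀ s : ℝ, s < 0 → ∀ᶠ k in Filter.atTop, 0 ≤ tc k + lam k ^ 2 * ν * s) ∧
          ∀ s : ℝ, s < 0 → ∀ y : EuclideanSpace ℝ (Fin 3),
            Filter.Tendsto (fun k => lam k • u (tc k + lam k ^ 2 * ν * s) (xc k + (lam k * ν) • y))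
              Filter.atTop (nhds (U s y))) ∧
        (ContinuousOn (Function.uncurry U) (Set.Iio 0 ×ˢ Set.univ) ∧ (∃ C : ℝ, ∀ t < 0, ∀ x, ‖U t x‖ ≤ C) ∧
          (∀ t < 0, IsWeaklyDivFree (U t)) ∧
          (∀ s t : ℝ, s < t → t < 0 → ∀ x,
            U t x = heatExtension (U s) (t - s) x - oseenDuhamel 1 s U U t x)) ∧
        (∃ t : ℝ, t < 0 ∧ ∃ x, U t x ≠ 0) ∧
        ((∀ s t : ℝ, s < 0 → t < 0 → U s = U t) ∨
          (∃ t₀ : ℝ, t₀ < 0 ∧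
            (∃ A : ℝ, ∀ σ : ℝ, 0 < σ → ∀ x, Real.sqrt σ * ‖heatExtension (U t₀) σ x‖ ≤ A) ∧
            (∀ φ : EuclideanSpace ℝ (Fin 3) → EuclideanSpace ℝ (Fin 3),
              IsTestFunctionOn (⊤ : TopologicalSpace.Opens (EuclideanSpace ℝ (Fin 3))) φ →
              Filter.Tendsto (fun lam : ℝ => ∫ x, inner ℝ (lam • U t₀ (lam • x)) (φ x))
                Filter.atTop (nhds 0))))) :
    Theses.RootDecompLeanestSingularity.LeanEnvelopedIsTypeI := by
  obtain ⟨ε, hε, hX⟩ := hX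
  refine ⟨ε, hε, fun ν T hν hT u p hmax hLH hdec hmarg hlean henv => ?_⟩
  by_contra hII
  obtain ⟨U, hzoom, hcls, hnt, hexit⟩ := hX ν T hν hT u p hmax hLH hdec hmarg hlean hII henv
  rcases hexit with hfrozen | hhollow
  · exact NoFrozenSpike.noFrozenSpike_proof ν T hν hT u p hmax hLH hdec henv U hzoom hcls hnt hfrozen
  · exact NoHollowSpike.noHollowSpike_proof ν T hν hT u p hmax hLH hdec henv U hzoom hcls hnt hhollow

/-- **N ⟹ X** (vacuity: under N no enveloped lean marginal Clay blow-up is Type II in time, so the exit statement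
has nothing to say). [lens-4 g11 `frozenOrHollow_of_leanEnvelopedIsTypeI`] -/
theorem frozenOrHollow_of_leanEnvelopedIsTypeI (hN : Theses.RootDecompLeanestSingularity.LeanEnvelopedIsTypeI) :
    ∃ ε : ℝ, 0 < ε ∧ ∀ (ν T : ℝ), 0 < ν → 0 < T →
      ∀ (u : ℝ → EuclideanSpace ℝ (Fin 3) → EuclideanSpace ℝ (Fin 3)) (p : ℝ → EuclideanSpace ℝ (Fin 3) → ℝ),
      IsMaximalSmoothSolution ν 0 u p T → IsLerayHopfOn T ν 0 (u 0) u → HasRapidSpatialDecay (u 0) →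
      (∀ ν' : ℝ, ν < ν' → HasGlobalKatoSolution ν' (u 0)) →
      (∀ v : EuclideanSpace ℝ (Fin 3) → EuclideanSpace ℝ (Fin 3),
        (ContDiff ℝ (⊤ : ℕ∞) v ∧ NSWave0.IsDivFree v ∧ HasRapidSpatialDecay v) →
        ¬ HasGlobalKatoSolution ν v → eLpNorm (u 0) 3 volume ≤ ENNReal.ofReal (1 + ε) * eLpNorm v 3 volume) →
      ¬ IsTypeIBlowup u T →
      (∃ M : ENNReal, M < ⊤ ∧ ∀ t : ℝ, 0 ≤ t → t < T → ∀ σ : ℝ, 0 < σ →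
        ENNReal.ofReal σ ^ 3 * volume {x : EuclideanSpace ℝ (Fin 3) | σ < ‖u t x‖} ≤ M) →
      ∃ U : ℝ → EuclideanSpace ℝ (Fin 3) → EuclideanSpace ℝ (Fin 3),
        (∃ (tc : ℕ → ℝ) (xc : ℕ → EuclideanSpace ℝ (Fin 3)) (lam : ℕ → ℝ), (∀ k, 0 < lam k) ∧
          (∀ k, tc k < T) ∧ (∀ s : ℝ, s < 0 → ∀ᶠ k in Filter.atTop, 0 ≤ tc k + lam k ^ 2 * ν * s) ∧
          ∀ s : ℝ, s < 0 → ∀ y : EuclideanSpace ℝ (Fin 3),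
            Filter.Tendsto (fun k => lam k • u (tc k + lam k ^ 2 * ν * s) (xc k + (lam k * ν) • y))
              Filter.atTop (nhds (U s y))) ∧
        (ContinuousOn (Function.uncurry U) (Set.Iio 0 ×ˢ Set.univ) ∧ (∃ C : ℝ, ∀ t < 0, ∀ x, ‖U t x‖ ≤ C) ∧
          (∀ t < 0, IsWeaklyDivFree (U t)) ∧
          (∀ s t : ℝ, s < t → t < 0 → ∀ x,
            U t x = heatExtension (U s) (t - s) x - oseenDuhamel 1 s U U t x)) ∧
        (∃ t : ℝ, t < 0 ∧ ∃ x, U t x ≠ 0) ∧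
        ((∀ s t : ℝ, s < 0 → t < 0 → U s = U t) ∨
          (∃ t₀ : ℝ, t₀ < 0 ∧
            (∃ A : ℝ, ∀ σ : ℝ, 0 < σ → ∀ x, Real.sqrt σ * ‖heatExtension (U t₀) σ x‖ ≤ A) ∧
            (∀ φ : EuclideanSpace ℝ (Fin 3) → EuclideanSpace ℝ (Fin 3),
              IsTestFunctionOn (⊤ : TopologicalSpace.Opens (EuclideanSpace ℝ (Fin 3))) φ →
              Filter.Tendsto (fun lam : ℝ => ∫ x, inner ℝ (lam • U t₀ (lam • x)) (φ x))
                Filter.atTop (nhds 0)))) := by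
  obtain ⟨ε, hε, hN⟩ := hN
  exact ⟨ε, hε, fun ν T hν hT u p hmax hLH hdec hmarg hlean hII henv =>
    (hII (hN ν T hν hT u p hmax hLH hdec hmarg hlean henv)).elim⟩

/-- **The Matano–Merle exit statement is N in disguise — unconditionally.** `X ↔ N`: inside a weak-`L³` envelope a
Navier–Stokes blow-up core can neither freeze (F, landed) nor hollow out (K, landed). [lens-4 g11
`frozenOrHollow_iff_noEnveloped`, its hypothesis S2 discharged by the tree theorem
`FrozenZoomIsLerayProfile.frozenZoomIsLerayProfile_proof`] -/
theorem frozenOrHollow_iff_leanEnvelopedIsTypeI :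
    (∃ ε : ℝ, 0 < ε ∧ ∀ (ν T : ℝ), 0 < ν → 0 < T →
      ∀ (u : ℝ → EuclideanSpace ℝ (Fin 3) → EuclideanSpace ℝ (Fin 3)) (p : ℝ → EuclideanSpace ℝ (Fin 3) → ℝ),
      IsMaximalSmoothSolution ν 0 u p T → IsLerayHopfOn T ν 0 (u 0) u → HasRapidSpatialDecay (u 0) →
      (∀ ν' : ℝ, ν < ν' → HasGlobalKatoSolution ν' (u 0)) →
      (∀ v : EuclideanSpace ℝ (Fin 3) → EuclideanSpace ℝ (Fin 3),
        (ContDiff ℝ (⊤ : ℕ∞) v ∧ NSWave0.IsDivFree v ∧ HasRapidSpatialDecay v) →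
        ¬ HasGlobalKatoSolution ν v → eLpNorm (u 0) 3 volume ≤ ENNReal.ofReal (1 + ε) * eLpNorm v 3 volume) →
      ¬ IsTypeIBlowup u T →
      (∃ M : ENNReal, M < ⊤ ∧ ∀ t : ℝ, 0 ≤ t → t < T → ∀ σ : ℝ, 0 < σ →
        ENNReal.ofReal σ ^ 3 * volume {x : EuclideanSpace ℝ (Fin 3) | σ < ‖u t x‖} ≤ M) →
      ∃ U : ℝ → EuclideanSpace ℝ (Fin 3) → EuclideanSpace ℝ (Fin 3),
        (∃ (tc : ℕ → ℝ) (xc : ℕ → EuclideanSpace ℝ (Fin 3)) (lam : ℕ → ℝ), (∀ k, 0 < lam k) ∧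
          (∀ k, tc k < T) ∧ (∀ s : ℝ, s < 0 → ∀ᶠ k in Filter.atTop, 0 ≤ tc k + lam k ^ 2 * ν * s) ∧
          ∀ s : ℝ, s < 0 → ∀ y : EuclideanSpace ℝ (Fin 3),
            Filter.Tendsto (fun k => lam k • u (tc k + lam k ^ 2 * ν * s) (xc k + (lam k * ν) • y))
              Filter.atTop (nhds (U s y))) ∧
        (ContinuousOn (Function.uncurry U) (Set.Iio 0 ×ˢ Set.univ) ∧ (∃ C : ℝ, ∀ t < 0, ∀ x, ‖U t x‖ ≤ C) ∧
          (∀ t < 0, IsWeaklyDivFree (U t)) ∧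
          (∀ s t : ℝ, s < t → t < 0 → ∀ x,
            U t x = heatExtension (U s) (t - s) x - oseenDuhamel 1 s U U t x)) ∧
        (∃ t : ℝ, t < 0 ∧ ∃ x, U t x ≠ 0) ∧
        ((∀ s t : ℝ, s < 0 → t < 0 → U s = U t) ∨
          (∃ t₀ : ℝ, t₀ < 0 ∧
            (∃ A : ℝ, ∀ σ : ℝ, 0 < σ → ∀ x, Real.sqrt σ * ‖heatExtension (U t₀) σ x‖ ≤ A) ∧
            (∀ φ : EuclideanSpace ℝ (Fin 3) → EuclideanSpace ℝ (Fin 3),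
              IsTestFunctionOn (⊤ : TopologicalSpace.Opens (EuclideanSpace ℝ (Fin 3))) φ →
              Filter.Tendsto (fun lam : ℝ => ∫ x, inner ℝ (lam • U t₀ (lam • x)) (φ x))
                Filter.atTop (nhds 0))))) ↔
    Theses.RootDecompLeanestSingularity.LeanEnvelopedIsTypeI :=
  ⟨leanEnvelopedIsTypeI_of_frozenOrHollow, frozenOrHollow_of_leanEnvelopedIsTypeI⟩

/-- **The residual NMT recomposes through the exit statement**: E `LeanTypeIIEnveloped` together with the
Matano–Merle exit statement X gives the node's parent residual NMT `LeanThresholdIsTypeI` (E ∧ N ⟹ NMT is the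
node's glue; N comes from X by the landed anatomy). -/
theorem leanThresholdIsTypeI_of_enveloped_of_frozenOrHollow
    (hE : Theses.RootDecompLeanestSingularity.LeanTypeIIEnveloped)
    (hX : ∃ ε : ℝ, 0 < ε ∧ ∀ (ν T : ℝ), 0 < ν → 0 < T →
      ∀ (u : ℝ → EuclideanSpace ℝ (Fin 3) → EuclideanSpace ℝ (Fin 3)) (p : ℝ → EuclideanSpace ℝ (Fin 3) → ℝ),
      IsMaximalSmoothSolution ν 0 u p T → IsLerayHopfOn T ν 0 (u 0) u → HasRapidSpatialDecay (u 0) →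
      (∀ ν' : ℝ, ν < ν' → HasGlobalKatoSolution ν' (u 0)) →
      (∀ v : EuclideanSpace ℝ (Fin 3) → EuclideanSpace ℝ (Fin 3),
        (ContDiff ℝ (⊤ : ℕ∞) v ∧ NSWave0.IsDivFree v ∧ HasRapidSpatialDecay v) →
        ¬ HasGlobalKatoSolution ν v → eLpNorm (u 0) 3 volume ≤ ENNReal.ofReal (1 + ε) * eLpNorm v 3 volume) →
      ¬ IsTypeIBlowup u T →
      (∃ M : ENNReal, M < ⊤ ∧ ∀ t : ℝ, 0 ≤ t → t < T → ∀ σ : ℝ, 0 < σ →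
        ENNReal.ofReal σ ^ 3 * volume {x : EuclideanSpace ℝ (Fin 3) | σ < ‖u t x‖} ≤ M) →
      ∃ U : ℝ → EuclideanSpace ℝ (Fin 3) → EuclideanSpace ℝ (Fin 3),
        (∃ (tc : ℕ → ℝ) (xc : ℕ → EuclideanSpace ℝ (Fin 3)) (lam : ℕ → ℝ), (∀ k, 0 < lam k) ∧
          (∀ k, tc k < T) ∧ (∀ s : ℝ, s < 0 → ∀ᶠ k in Filter.atTop, 0 ≤ tc k + lam k ^ 2 * ν * s) ∧
          ∀ s : ℝ, s < 0 → ∀ y : EuclideanSpace ℝ (Fin 3),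
            Filter.Tendsto (fun k => lam k • u (tc k + lam k ^ 2 * ν * s) (xc k + (lam k * ν) • y))
              Filter.atTop (nhds (U s y))) ∧
        (ContinuousOn (Function.uncurry U) (Set.Iio 0 ×ˢ Set.univ) ∧ (∃ C : ℝ, ∀ t < 0, ∀ x, ‖U t x‖ ≤ C) ∧
          (∀ t < 0, IsWeaklyDivFree (U t)) ∧
          (∀ s t : ℝ, s < t → t < 0 → ∀ x,
            U t x = heatExtension (U s) (t - s) x - oseenDuhamel 1 s U U t x)) ∧
        (∃ t : ℝ, t < 0 ∧ ∃ x, U t x ≠ 0) ∧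
        ((∀ s t : ℝ, s < 0 → t < 0 → U s = U t) ∨
          (∃ t₀ : ℝ, t₀ < 0 ∧
            (∃ A : ℝ, ∀ σ : ℝ, 0 < σ → ∀ x, Real.sqrt σ * ‖heatExtension (U t₀) σ x‖ ≤ A) ∧
            (∀ φ : EuclideanSpace ℝ (Fin 3) → EuclideanSpace ℝ (Fin 3),
              IsTestFunctionOn (⊤ : TopologicalSpace.Opens (EuclideanSpace ℝ (Fin 3))) φ →
              Filter.Tendsto (fun lam : ℝ => ∫ x, inner ℝ (lam • U t₀ (lam • x)) (φ x))
                Filter.atTop (nhds 0))))) :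
    Theses.RootDecompLeanestSingularity.LeanThresholdIsTypeI := by
  obtain ⟨εN, hεN, hN⟩ := leanEnvelopedIsTypeI_of_frozenOrHollow hX
  obtain ⟨εE, hεE, hE⟩ := hE
  refine ⟨min εE εN, lt_min hεE hεN, fun ν T hν hT u p hmax hLH hdec hmarg hlean => ?_⟩
  have hleanE : ∀ v : EuclideanSpace ℝ (Fin 3) → EuclideanSpace ℝ (Fin 3),
      (ContDiff ℝ (⊤ : ℕ∞) v ∧ NSWave0.IsDivFree v ∧ HasRapidSpatialDecay v) →
      ¬ HasGlobalKatoSolution ν v → eLpNorm (u 0) 3 volume ≤ ENNReal.ofReal (1 + εE) * eLpNorm v 3 volume :=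
    fun v hv hnk => (hlean v hv hnk).trans <| by
      gcongr
      exact min_le_left _ _
  have hleanN : ∀ v : EuclideanSpace ℝ (Fin 3) → EuclideanSpace ℝ (Fin 3),
      (ContDiff ℝ (⊤ : ℕ∞) v ∧ NSWave0.IsDivFree v ∧ HasRapidSpatialDecay v) →
      ¬ HasGlobalKatoSolution ν v → eLpNorm (u 0) 3 volume ≤ ENNReal.ofReal (1 + εN) * eLpNorm v 3 volume :=
    fun v hv hnk => (hlean v hv hnk).trans <| by
      gcongr
      exact min_le_right _ _
  by_contra hII
  exact hII (hN ν T hν hT u p hmax hLH hdec hmarg hleanN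
    (hE ν T hν hT u p hmax hLH hdec hmarg hleanE hII))

end Summit.NavierStokesRegularity.NavierStokesRegularity.Theorems.SpikeExits
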